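import Literature.NumberTheory.GaloisRepresentations.ProfiniteIntersectionCocycleExtension
import Literature.NumberTheory.GaloisRepresentations.ContinuousCorestriction
import Literature.NumberTheory.GaloisRepresentations.ContinuousH1
import HarnessLib

/-!
# Continuous `1`-cocycles on an intersection of closed subgroups come from a finite stage: `H¹(⋂ Sₖ, X) = ⋃ₖ res H¹(Sₖ, X)` (surjectivity half of
# the continuity of `H¹`) — the generic core of the AwayTwo frame's EXHAUSTION lemma

Route `ResidualThetaTransportAtTwo` (RTT), crux RSL_g `ResidualSignedLambdaLowerCMAtTwo` (stmt-BirchSwinnertonDyer-22608), line «onepair»; seat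
`prover-bsd-wall-tp2-p2x-w2` g19 (`--supports`, closes nothing). THEOREMS ONLY (no definition, no named fact, no instance, no `sorry`). BSD is not
proved by any of this; RSL_g (22608) stays OPEN.

WHY. The `S₀`-side frame of the line (AWAYTWO-FRAME-g18, rtt-p2 LEAD g18) pins the Pontryagin character `locdS x w c` of
`Dloc w = H¹(U∞_w, A_ρ)` (`U∞_w = Gal(ℚ̄_w/ℚ_{∞,w̃}) = ⋂ₙ U_{n,w}`) LEVELWISE, on the images `jAway w n k : H¹(U_{n,w}, A_ρ[2^k]) → Dloc w`; its
well-posedness / uniqueness and the `S₀`-pin transfer of S4₂ (STUB-PLAN rev 22 S95 step (5)) need the EXHAUSTION «every `y : Dloc w` is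
`jAway w n k y'` for some `n ≥ nfl w`, `k`» — the critic's «one link not in the tree» (Q93). Its subgroup half is the degree-1 twin of
`Literature/…/ProfiniteIntersectionCocycleExtension.lean` (`exists_resSub_eq_of_iInf`: degree 2, finite coefficients), proved here in the
`subgroupRep`/`resLe` dialect of `ContinuousCorestriction` that `Dloc`/`Dlev`/`jAway` are written in, for ANY discrete coefficients.

* **`exists_resLe_eq_of_iInf`**: `G` a compact totally disconnected topological group, `X : TopRep R G` with discrete carrier and continuous
  orbit maps, `S : ℕ → Subgroup G` antitone and closed. Every class `y ∈ H¹(⨅ₖ Sₖ, X)` is `resLe X (iInf_le S k) 1 y'` for some `k` and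
  `y' ∈ H¹(Sₖ, X)`. Proof (Serre I §2.2 Prop. 8): a continuous crossed homomorphism `φ` on the compact `S_∞ = ⨅ Sₖ` has finite image; choose
  an open normal `W ⊴ G` fixing that image pointwise and with `φ = 0` on `S_∞ ∩ W`; by compactness some `Sₖ ⊆ S_∞ · W`
  (`exists_coe_subset_mul`); `φ̃(σ) := φ(s)` for `σ ∈ s W`, `s ∈ S_∞`, is well defined, a continuous crossed homomorphism on `Sₖ`, and restricts to `φ`.
* **`exists_resLe_eq_of_iInf_from`**: the same with the stage `k` taken `≥ n₀` (the frame's floor `nfl w`).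

References: [SerreGaloisCohomology1997] I §2.2 Prop. 8, I §5.1; [Shatz1972] Ch. II §2; [NeukirchSchmidtWingberg2008] I §2 (1.2.5), I §5.
-/

set_option autoImplicit false
-- the Theorems namespace of this sub repeats the summit name by design (D-0017 nested layout)
set_option linter.dupNamespace false

noncomputable section

open scoped Pointwise
open CategoryTheory Topology Filter

namespace Summit.BirchSwinnertonDyer.BirchSwinnertonDyer.Theorems.ThetaTransport.ProfiniteExhaustion

open Literature.NumberTheory.GaloisRepresentations

universe u v

variable {R : Type u} [Ring R] [TopologicalSpace R]
  {G : Type v} [Group G] [TopologicalSpace G] [IsTopologicalGroup G] [CompactSpace G] [TotallyDisconnectedSpace G]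
  (X : TopRep.{v} R G) [DiscreteTopology X]

/-- **Every class of `H¹(⨅ₖ Sₖ, X)` is restricted from some `H¹(Sₖ, X)`** (`G` compact totally disconnected, `X` discrete with continuous
orbit maps, `Sₖ` antitone closed): the surjectivity half of `H¹(⋂ Sₖ, X) = lim→ H¹(Sₖ, X)`.
[cite: SerreGaloisCohomology1997, I §2.2 Prop. 8] [cite: Shatz1972, Ch. II §2] -/
theorem exists_resLe_eq_of_iInf (hX : ∀ a : X, Continuous fun g : G ↦ X.ρ g a)
    (S : ℕ → Subgroup G) (hS : Antitone S) (hcl : ∀ k, IsClosed ((S k : Subgroup G) : Set G))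
    (y : continuousCohomology 1 (subgroupRep X (⨅ k, S k))) :
    ∃ (k : ℕ) (y' : continuousCohomology 1 (subgroupRep X (S k))), resLe X (iInf_le S k) 1 y' = y := by
  classical
  have hScl : IsClosed (((⨅ k, S k : Subgroup G)) : Set G) := by
    rw [Subgroup.coe_iInf]; exact isClosed_iInter hcl
  haveI : CompactSpace ↥(⨅ k, S k : Subgroup G) := isCompact_iff_compactSpace.mp hScl.isCompact
  obtain ⟨φ, hφ⟩ := oneCocycleClass_surjective (subgroupRep X (⨅ k, S k)) y
  -- (1) the image of `φ` is finite; an open set `U₁ ∋ 1` of `G` on which every element fixes the image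
  have hfin : (Set.range φ.1).Finite := (isCompact_range φ.1.continuous).finite_of_discrete
  have hU₁ : (⋂ a ∈ Set.range φ.1, {g : G | X.ρ g a = a}) ∈ 𝓝 (1 : G) := by
    refine (Filter.biInter_mem hfin).2 fun a _ ↦ ?_
    exact ((isOpen_discrete ({a} : Set X)).preimage (hX a)).mem_nhds (by simp)
  -- (2) an open set `U₂ ∋ 1` of `G` with `φ = 0` on `(⨅ k, S k : Subgroup G) ∩ U₂`
  have h0 : IsOpen {s : (⨅ k, S k : Subgroup G) | φ.1 s = 0} := (isOpen_discrete ({0} : Set X)).preimage φ.1.continuous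
  obtain ⟨U₂, hU₂o, hU₂⟩ := isOpen_induced_iff.1 h0
  have h1U₂ : (1 : G) ∈ U₂ := by
    have : (1 : (⨅ k, S k : Subgroup G)) ∈ Subtype.val ⁻¹' U₂ := by rw [hU₂]; exact contOneCocycles.apply_one φ
    exact this
  -- (3) an open normal subgroup inside both
  have h1 : (1 : G) ∈ interior ((⋂ a ∈ Set.range φ.1, {g : G | X.ρ g a = a}) ∩ U₂) :=
    mem_interior_iff_mem_nhds.2 (inter_mem hU₁ (hU₂o.mem_nhds h1U₂))
  obtain ⟨W, hW⟩ := ProfiniteGrp.exist_openNormalSubgroup_sub_open_nhds_of_one isOpen_interior h1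
  have hW' : (W : Set G) ⊆ (⋂ a ∈ Set.range φ.1, {g : G | X.ρ g a = a}) ∩ U₂ := hW.trans interior_subset
  have hWfix : ∀ g ∈ W, ∀ s : (⨅ k, S k : Subgroup G), X.ρ g (φ.1 s) = φ.1 s := fun g hg s ↦ by
    have h := (hW' hg).1
    rw [Set.mem_iInter₂] at h
    exact h (φ.1 s) ⟨s, rfl⟩
  have hWzero : ∀ s : (⨅ k, S k : Subgroup G), (s : G) ∈ W → φ.1 s = 0 := fun s hs ↦ by
    have h : s ∈ Subtype.val ⁻¹' U₂ := (hW' hs).2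
    rw [hU₂] at h
    exact h
  -- (4) some `S k ⊆ (⨅ k, S k : Subgroup G) · W`
  obtain ⟨k, hk⟩ := exists_coe_subset_mul S hS hcl W.toSubgroup W.isOpen
  -- representatives `s(σ) ∈ (⨅ k, S k : Subgroup G)` with `s(σ)⁻¹ σ ∈ W`
  have hrep : ∀ σ : S k, ∃ s : (⨅ k, S k : Subgroup G), ((s : G))⁻¹ * σ ∈ W := fun σ ↦ by
    obtain ⟨s, hs, w', hw', hsw⟩ := Set.mem_mul.1 (hk σ.2)
    refine ⟨⟨s, hs⟩, ?_⟩
    change s⁻¹ * (σ : G) ∈ (W : Subgroup G)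
    rw [← hsw, inv_mul_cancel_left]
    exact hw'
  choose rep hrep using hrep
  -- well-definedness: the value `φ s` does not depend on the representative
  have hwd : ∀ (σ : S k) (s : (⨅ k, S k : Subgroup G)), ((s : G))⁻¹ * σ ∈ W → φ.1 s = φ.1 (rep σ) := by
    intro σ s hs
    have hmem : ((s : G))⁻¹ * (rep σ : G) ∈ W := inv_mul_mem_of_reps (W := W.toSubgroup) hs (hrep σ)
    have hu := hWzero ⟨((s : G))⁻¹ * (rep σ : G), (⨅ k, S k : Subgroup G).mul_mem ((⨅ k, S k : Subgroup G).inv_mem s.2) (rep σ).2⟩ hmem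
    have e : rep σ = s * ⟨((s : G))⁻¹ * (rep σ : G), (⨅ k, S k : Subgroup G).mul_mem ((⨅ k, S k : Subgroup G).inv_mem s.2) (rep σ).2⟩ :=
      Subtype.ext (by change (rep σ : G) = s * (((s : G))⁻¹ * (rep σ : G)); rw [mul_inv_cancel_left])
    rw [e, φ.2, hu, map_zero, add_zero]
  -- the extended function and its properties
  have hcont : Continuous fun σ : S k ↦ φ.1 (rep σ) := by
    refine continuous_discrete_rng.2 fun a ↦ isOpen_iff_mem_nhds.2 fun σ hσ ↦ ?_
    have hO : IsOpen {σ' : S k | ((σ : G))⁻¹ * σ' ∈ W} :=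
      W.isOpen.preimage (continuous_const.mul continuous_subtype_val)
    refine Filter.mem_of_superset (hO.mem_nhds (by simp)) fun σ' hσ' ↦ ?_
    rw [Set.mem_preimage, Set.mem_singleton_iff] at hσ ⊢
    rw [← hσ]
    -- `rep σ` is also a representative of `σ'`
    have h2 : ((rep σ : G))⁻¹ * σ' ∈ W := by
      have h := W.toSubgroup.mul_mem (hrep σ) hσ'
      rwa [mul_assoc, mul_inv_cancel_left] at h
    exact (hwd σ' (rep σ) h2).symm
  have hact : ∀ (σ : S k) (t : (⨅ k, S k : Subgroup G)), X.ρ (σ : G) (φ.1 t) = X.ρ (rep σ : G) (φ.1 t) := fun σ t ↦ by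
    have e : (σ : G) = (rep σ : G) * (((rep σ : G))⁻¹ * σ) := by rw [mul_inv_cancel_left]
    conv_lhs => rw [e, map_mul]
    change X.ρ (rep σ : G) (X.ρ (((rep σ : G))⁻¹ * σ) (φ.1 t)) = _
    rw [hWfix _ (hrep σ) t]
  let ψ : contOneCocycles (subgroupRep X (S k)) :=
    ⟨⟨fun σ ↦ φ.1 (rep σ), hcont⟩, fun σ τ ↦ by
      change φ.1 (rep (σ * τ)) = φ.1 (rep σ) + (subgroupRep X (S k)).ρ σ (φ.1 (rep τ))
      have hστ : ((rep σ * rep τ : (⨅ k, S k : Subgroup G)) : G)⁻¹ * ((σ * τ : S k) : G) ∈ W := mul_rep_mem (W := W.toSubgroup) (hrep σ) (hrep τ)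
      rw [← hwd (σ * τ) (rep σ * rep τ) hστ, φ.2, subgroupRep_ρ_apply, subgroupRep_ρ_apply, hact]⟩
  refine ⟨k, oneCocycleClass _ ψ, ?_⟩
  rw [← hφ, resLe_oneCocycleClass]
  congr 1
  refine Subtype.ext (ContinuousMap.ext fun s ↦ ?_)
  rw [contOneCocycles.pullback_apply]
  change φ.1 (rep (Literature.NumberTheory.EllipticCurves.subgroupInclusion (iInf_le S k) s)) = φ.1 s
  have h1 : ((s : G))⁻¹ * (Literature.NumberTheory.EllipticCurves.subgroupInclusion (iInf_le S k) s : G) ∈ W := by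
    rw [Literature.NumberTheory.EllipticCurves.subgroupInclusion_apply_coe, inv_mul_cancel]
    exact W.toSubgroup.one_mem
  exact (hwd _ s h1).symm

/-- **The same with the stage beyond a floor `n₀`** (the frame's `nfl w`): `Sₖ` for `k ≥ n₀` still exhausts. [cite: SerreGaloisCohomology1997, I §2.2 Prop. 8] -/
theorem exists_resLe_eq_of_iInf_from (hX : ∀ a : X, Continuous fun g : G ↦ X.ρ g a)
    (S : ℕ → Subgroup G) (hS : Antitone S) (hcl : ∀ k, IsClosed ((S k : Subgroup G) : Set G)) (n₀ : ℕ)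
    (y : continuousCohomology 1 (subgroupRep X (⨅ k, S k))) :
    ∃ (k : ℕ) (_ : n₀ ≤ k) (y' : continuousCohomology 1 (subgroupRep X (S k))), resLe X (iInf_le S k) 1 y' = y := by
  obtain ⟨k, y', hy'⟩ := exists_resLe_eq_of_iInf X hX S hS hcl y
  obtain ⟨φ, rfl⟩ := oneCocycleClass_surjective _ y'
  refine ⟨max n₀ k, le_max_left _ _, resLe X (hS (le_max_right n₀ k)) 1 (oneCocycleClass _ φ), ?_⟩
  rw [← hy', resLe_oneCocycleClass, resLe_oneCocycleClass, resLe_oneCocycleClass]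
  congr 1

end Summit.BirchSwinnertonDyer.BirchSwinnertonDyer.Theorems.ThetaTransport.ProfiniteExhaustion

end
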